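import Summits.AtomisticToContinuum.FouriersLaw.Theorems.JunctionLocalityNonBallisticLightConePropagation

/-!
# Weighted common-noise propagation bound for the flow of the open pinned chain (light cone of (C′), pathwise core)

Helper (`--supports stmt-AtomisticToContinuum-14013`) for the line `series-law-at-every-laplace-frequency`
(SketchIdeator2) of the crux `LatticeLandauDamping.AbelThermodynamicLimit`, stub (C′)
`stub_uniformAnchoredCorrelationTails` (the light cone of the OPEN chain at fixed time, anchor-uniform and
`N`-uniform). Registered sub-goal `chainFlow_momentumFlip_propagation_weighted`.

The landed propagation bound `NonBallistic.LightConePropagation.chainFlow_momentumFlip_propagation_explicit`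
compares two solutions `z = chainFlow x η`, `z' = chainFlow (x^{i₀}) η` (`x^{i₀} = momentumFlip i₀ x`, SAME
continuous noise path `η`) under a GLOBAL box `|q_j(s)| ≤ R` for ALL sites `j`; under the stationary law the
probability of that box tends to one only if `R` grows with `N`, which is useless for an `N`-UNIFORM light cone.
Here the box is WEIGHTED by the distance to the flipped site: positions near site `j` are only required to
satisfy `q² ≤ ρ² g(|j - i₀|)` for an admissible weight `g` (the four hypotheses of the abstract Dobrushin–Fritz
iteration `BMLightCone.lattice_iteration_far`: `1 ≤ g`, monotone, `g(n) ≤ 3 + n`, `g(2m)/m` antitone; e.g.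
`g(n) = √(1+n)`), so that the local Lipschitz rate of the cubic forces at site `j` is `≤ A ρ² g(|j - i₀|)`
(`A = 3 + ω₂ + 3 lam + 24 β + 2γ`), exactly the site-dependent rate the abstract iteration allows. Conclusion:

  `|q'_k(t) - q_k(t)| + |p'_k(t) - p_k(t)| ≤ 2 · (2|p_{i₀}|) · (1/2)^{|k - i₀|}`
  whenever `2e · 3 (A ρ²) g(2|k - i₀|) t ≤ |k - i₀|`.

Under the stationary law `μ_T ⊗ W` the weighted box fails with probability `≤ C ρ^{-2m} Σ_n g(n)^{-m}`,
summable over the sites UNIFORMLY in `N` — this is what makes the light cone of (C′) `N`-uniform.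

Contents: local (three-site) versions of the box Lipschitz bounds of `…LightConePropagationAux1`
(`abs_dPotential_sub_le_local`, `abs_drift_snd_sub_le_local`) and the weighted propagation bound. Pure analysis.
-/

noncomputable section

open MeasureTheory Set Filter Topology

namespace Summit.AtomisticToContinuum.FouriersLaw.Theorems.AbelThermodynamicLimit.SeriesLawAtEveryLaplaceFrequency

open Literature.MathematicalPhysics.KineticTheory.HeatConduction
open Summit.AtomisticToContinuum.FouriersLaw.Theorems.NonBallistic.LightConePropagation

namespace WeightedPropagation

variable {N : ℕ} {ω₂ lam β γ : ℝ}

/-- **Local Lipschitz bound for the force of the pinned chain.** If the positions of `q` and `q'` at the three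
sites `i-1, i, i+1` lie in `[-R, R]` and `|q'_j - q_j| ≤ d_j` for a nonnegative `d : ℤ → ℝ`, then
`|∂_iΦ(q') - ∂_iΦ(q)| ≤ (ω₂ + 3 lam R² + 2(1 + 12 β R²)) d_i + (1 + 12 β R²)(d_{i-1} + d_{i+1})`
(the force at site `i` only sees these three positions). [folklore] -/
theorem abs_dPotential_sub_le_local (hω : 0 ≤ ω₂) (hl : 0 ≤ lam) (hβ : 0 ≤ β) (γ : ℝ) {R : ℝ}
    {q q' : Fin N → ℝ} (i : Fin N)
    (hq : ∀ j : Fin N, ((j : ℤ) - i).natAbs ≤ 1 → |q j| ≤ R)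
    (hq' : ∀ j : Fin N, ((j : ℤ) - i).natAbs ≤ 1 → |q' j| ≤ R)
    {d : ℤ → ℝ} (hd0 : ∀ k, 0 ≤ d k) (hd : ∀ j : Fin N, |q' j - q j| ≤ d j) :
    |(pinnedChain ω₂ lam β γ).dPotential N i q' - (pinnedChain ω₂ lam β γ).dPotential N i q| ≤
      (ω₂ + 3 * lam * R ^ 2 + 2 * (1 + 12 * β * R ^ 2)) * d i +
        (1 + 12 * β * R ^ 2) * (d (i - 1) + d (i + 1)) := by
  rw [OscillatorChain.dPotential_eq_closed, OscillatorChain.dPotential_eq_closed]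
  simp only [pinnedChain_deriv_U, pinnedChain_deriv_V]
  set KV := 1 + 12 * β * R ^ 2 with hKV_def
  have hii : ((i : ℤ) - i).natAbs ≤ 1 := by simp
  have hR : 0 ≤ R := (abs_nonneg _).trans (hq i hii)
  have hKV : 0 ≤ KV := by positivity
  -- pinning term
  have hU : |(ω₂ * q' i + lam * q' i ^ 3) - (ω₂ * q i + lam * q i ^ 3)| ≤
      (ω₂ + 3 * lam * R ^ 2) * d i :=
    (abs_cubic_sub_cubic_le hω hl (hq' i hii) (hq i hii)).trans
      (mul_le_mul_of_nonneg_left (hd i) (by positivity))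
  -- a bond term between two sites of the three-site window
  have hV : ∀ j l : Fin N, ((j : ℤ) - i).natAbs ≤ 1 → ((l : ℤ) - i).natAbs ≤ 1 →
      |(q' l - q' j + β * (q' l - q' j) ^ 3) - (q l - q j + β * (q l - q j) ^ 3)| ≤
      KV * (d l + d j) := by
    intro j l hj hlw
    have h2R : |q l - q j| ≤ 2 * R := (abs_sub _ _).trans (by linarith [hq l hlw, hq j hj])
    have h2R' : |q' l - q' j| ≤ 2 * R := (abs_sub _ _).trans (by linarith [hq' l hlw, hq' j hj])
    have h := abs_cubic_sub_cubic_le (c₁ := 1) zero_le_one hβ h2R' h2R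
    rw [one_mul, one_mul] at h
    refine h.trans ?_
    have e : (1 + 3 * β * (2 * R) ^ 2) = KV := by rw [hKV_def]; ring
    rw [e]
    refine mul_le_mul_of_nonneg_left ?_ hKV
    calc |q' l - q' j - (q l - q j)| = |(q' l - q l) - (q' j - q j)| := by ring_nf
      _ ≤ |q' l - q l| + |q' j - q j| := abs_sub _ _
      _ ≤ d l + d j := add_le_add (hd l) (hd j)
  -- left bond
  have hL : |(if h : 0 < i.val then q' i - q' ⟨i.val - 1, by omega⟩ + β * (q' i - q' ⟨i.val - 1, by omega⟩) ^ 3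
        else 0) -
      (if h : 0 < i.val then q i - q ⟨i.val - 1, by omega⟩ + β * (q i - q ⟨i.val - 1, by omega⟩) ^ 3
        else 0)| ≤ KV * (d i + d (i - 1)) := by
    by_cases h : 0 < i.val
    · rw [dif_pos h, dif_pos h]
      have e : (((⟨i.val - 1, by omega⟩ : Fin N) : ℕ) : ℤ) = (i : ℤ) - 1 := by
        show ((i.val - 1 : ℕ) : ℤ) = (i : ℤ) - 1
        omega
      have hw : ((((⟨i.val - 1, by omega⟩ : Fin N) : ℕ) : ℤ) - i).natAbs ≤ 1 := by rw [e]; simp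
      have h1 := hV ⟨i.val - 1, by omega⟩ i hw hii
      rwa [e] at h1
    · rw [dif_neg h, dif_neg h, sub_zero, abs_zero]
      exact mul_nonneg hKV (add_nonneg (hd0 _) (hd0 _))
  -- right bond
  have hRb : |(if h : i.val + 1 < N then q' ⟨i.val + 1, h⟩ - q' i + β * (q' ⟨i.val + 1, h⟩ - q' i) ^ 3
        else 0) -
      (if h : i.val + 1 < N then q ⟨i.val + 1, h⟩ - q i + β * (q ⟨i.val + 1, h⟩ - q i) ^ 3
        else 0)| ≤ KV * (d (i + 1) + d i) := by
    by_cases h : i.val + 1 < N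
    · rw [dif_pos h, dif_pos h]
      have e : (((⟨i.val + 1, h⟩ : Fin N) : ℕ) : ℤ) = (i : ℤ) + 1 := by
        show ((i.val + 1 : ℕ) : ℤ) = (i : ℤ) + 1
        omega
      have hw : ((((⟨i.val + 1, h⟩ : Fin N) : ℕ) : ℤ) - i).natAbs ≤ 1 := by rw [e]; simp
      have h1 := hV i ⟨i.val + 1, h⟩ hii hw
      rwa [e] at h1
    · rw [dif_neg h, dif_neg h, sub_zero, abs_zero]
      exact mul_nonneg hKV (add_nonneg (hd0 _) (hd0 _))
  -- combine
  have key : ∀ (u u' v v' w w' : ℝ), (u' + v' - w') - (u + v - w) = (u' - u) + (v' - v) - (w' - w) := by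
    intros; ring
  rw [key]
  refine (abs_sub _ _).trans ((add_le_add ((abs_add_le _ _).trans (add_le_add hU hL)) hRb).trans ?_)
  nlinarith [hd0 i, hd0 (i - 1), hd0 (i + 1)]

/-- **Local Lipschitz bound for the momentum drift of the pinned chain**: with `d` dominating the position AND
momentum differences and the positions at the sites `i-1, i, i+1` of both states in `[-R, R]`,
`|Y(z')_{p,i} - Y(z)_{p,i}| ≤ (ω₂ + 3 lam R² + 2(1 + 12βR²) + 2γ) d_i + (1 + 12βR²)(d_{i-1} + d_{i+1})`.
[folklore] -/
theorem abs_drift_snd_sub_le_local (hω : 0 ≤ ω₂) (hl : 0 ≤ lam) (hβ : 0 ≤ β) (hγ : 0 ≤ γ) {R : ℝ}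
    {z z' : PhaseSpace N} (i : Fin N)
    (hq : ∀ j : Fin N, ((j : ℤ) - i).natAbs ≤ 1 → |z.1 j| ≤ R)
    (hq' : ∀ j : Fin N, ((j : ℤ) - i).natAbs ≤ 1 → |z'.1 j| ≤ R)
    {d : ℤ → ℝ} (hd0 : ∀ k, 0 ≤ d k) (hd1 : ∀ j : Fin N, |z'.1 j - z.1 j| ≤ d j)
    (hd2 : ∀ j : Fin N, |z'.2 j - z.2 j| ≤ d j) :
    |((pinnedChain ω₂ lam β γ).drift N z').2 i - ((pinnedChain ω₂ lam β γ).drift N z).2 i| ≤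
      (ω₂ + 3 * lam * R ^ 2 + 2 * (1 + 12 * β * R ^ 2) + 2 * γ) * d i +
        (1 + 12 * β * R ^ 2) * (d (i - 1) + d (i + 1)) := by
  rw [pinnedChain_drift_apply, pinnedChain_drift_apply]
  dsimp only
  have hF := abs_dPotential_sub_le_local hω hl hβ γ i hq hq' hd0 hd1
  have hw0 := bathWeight_nonneg N i
  have hw2 := bathWeight_le_two N i
  have hfr : |γ * OscillatorChain.bathWeight N i * z'.2 i - γ * OscillatorChain.bathWeight N i * z.2 i| ≤
      2 * γ * d i := by
    rw [← mul_sub, abs_mul, abs_of_nonneg (mul_nonneg hγ hw0)]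
    calc γ * OscillatorChain.bathWeight N i * |z'.2 i - z.2 i| ≤ γ * 2 * d i :=
          mul_le_mul (mul_le_mul_of_nonneg_left hw2 hγ) (hd2 i) (abs_nonneg _) (by positivity)
      _ = 2 * γ * d i := by ring
  have key : ∀ F F' f f' : ℝ, (-F' - f') - (-F - f) = -((F' - F) + (f' - f)) := by intros; ring
  rw [key, abs_neg]
  refine (abs_add_le _ _).trans ((add_le_add hF hfr).trans (le_of_eq ?_))
  ring

/-- **Weighted common-noise propagation bound** (pathwise core of the `N`-uniform light cone of the open chain).
Two solutions of the Langevin integral equation of the pinned chain driven by the SAME continuous noise path,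
from `x` and from `x` with the momentum of site `i₀` flipped, whose positions near every site `j` (sites `j'` with
`|j' - j| ≤ 1`) satisfy `q² ≤ ρ² g(|j - i₀|)` on `[0, t]` for an admissible weight `g` (`1 ≤ g`, monotone,
`g(n) ≤ 3 + n`, `m g(2m') ≤ m' g(2m)` for `1 ≤ m ≤ m'`) and a scale `ρ ≥ 1`, differ at any site `k ≠ i₀` by at most
`2 · 2|p_{i₀}| · 2^{-|k - i₀|}` in the light-cone regime `2e · 3 (A ρ²) g(2|k - i₀|) t ≤ |k - i₀|`,
`A = 3 + ω₂ + 3 lam + 24 β + 2γ`: the site deviations `u_k = |δq_k| + |δp_k|` (extended by zero to `ℤ`) obey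
`u_k(τ) ≤ u_k(0) + A ρ² g(|k - i₀|) ∫₀^τ (u_{k-1} + u_k + u_{k+1})`, and `BMLightCone.lattice_iteration_far` applies
with the weight `g`. [folklore] -/
theorem propagation_weighted (hω : 0 < ω₂) (hl : 0 ≤ lam) (hβ : 0 ≤ β) (hγ : 0 ≤ γ)
    {g : ℕ → ℝ} (hg1 : ∀ n, 1 ≤ g n) (hgm : Monotone g) (hg3 : ∀ n : ℕ, g n ≤ 3 + n)
    (hg4 : ∀ m m' : ℕ, 1 ≤ m → m ≤ m' → (m : ℝ) * g (2 * m') ≤ m' * g (2 * m))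
    (N : ℕ) (i₀ : Fin N) (x : PhaseSpace N) {η : ℝ → Fin N → ℝ} (hη : Continuous η) {ρ t : ℝ}
    (hρ : 1 ≤ ρ) (ht : 0 ≤ t)
    (hbox : ∀ s ∈ Icc 0 t, ∀ j j' : Fin N, ((j' : ℤ) - j).natAbs ≤ 1 →
      ((pinnedChain ω₂ lam β γ).chainFlow N x η s).1 j' ^ 2 ≤ ρ ^ 2 * g ((j : ℤ) - i₀).natAbs ∧
      ((pinnedChain ω₂ lam β γ).chainFlow N (momentumFlip i₀ x) η s).1 j' ^ 2 ≤ ρ ^ 2 * g ((j : ℤ) - i₀).natAbs)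
    {k : Fin N} (hk : k ≠ i₀)
    (hθ : 2 * Real.exp 1 * (3 * ((3 + ω₂ + 3 * lam + 24 * β + 2 * γ) * ρ ^ 2) *
      g (2 * ((k : ℤ) - (i₀ : ℤ)).natAbs) * t) ≤ ((k : ℤ) - (i₀ : ℤ)).natAbs) :
    |((pinnedChain ω₂ lam β γ).chainFlow N (momentumFlip i₀ x) η t).1 k -
        ((pinnedChain ω₂ lam β γ).chainFlow N x η t).1 k| +
      |((pinnedChain ω₂ lam β γ).chainFlow N (momentumFlip i₀ x) η t).2 k -
        ((pinnedChain ω₂ lam β γ).chainFlow N x η t).2 k| ≤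
      2 * (2 * |x.2 i₀|) * (1 / 2) ^ ((k : ℤ) - (i₀ : ℤ)).natAbs := by
  -- adapted from `NonBallistic.LightConePropagation.chainFlow_momentumFlip_propagation_explicit`
  have hk' : 1 ≤ ((k : ℤ) - (i₀ : ℤ)).natAbs := by have := Fin.val_ne_of_ne hk; omega
  have hg0 : ∀ n, 0 ≤ g n := fun n => zero_le_one.trans (hg1 n)
  -- the two flows, the site deviations `v` and their lattice extension `u`
  set z : ℝ → PhaseSpace N := (pinnedChain ω₂ lam β γ).chainFlow N x η with hz
  set z' : ℝ → PhaseSpace N := (pinnedChain ω₂ lam β γ).chainFlow N (momentumFlip i₀ x) η with hz'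
  set v : Fin N → ℝ → ℝ := fun j s => |(z' s).1 j - (z s).1 j| + |(z' s).2 j - (z s).2 j| with hv
  set u : ℤ → ℝ → ℝ := fun l s => ∑ j : Fin N, if (j : ℤ) = l then v j s else 0 with hu
  have hu_coe : ∀ (j : Fin N) (s : ℝ), u j s = v j s := fun j s => latticeSum_coe (fun j => v j s) j
  have hv0 : ∀ j s, 0 ≤ v j s := fun j s => add_nonneg (abs_nonneg _) (abs_nonneg _)
  have hu0 : ∀ l s, 0 ≤ u l s := fun l s => latticeSum_nonneg (fun j => hv0 j s) l
  have hd1 : ∀ (s : ℝ) (j : Fin N), |(z' s).1 j - (z s).1 j| ≤ u j s := fun s j => by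
    rw [hu_coe]; exact le_add_of_nonneg_right (abs_nonneg _)
  have hd2 : ∀ (s : ℝ) (j : Fin N), |(z' s).2 j - (z s).2 j| ≤ u j s := fun s j => by
    rw [hu_coe]; exact le_add_of_nonneg_left (abs_nonneg _)
  -- continuity
  have hzc : Continuous z := pinnedChain_continuous_chainFlow hω hl hβ hγ N x hη
  have hz'c : Continuous z' := pinnedChain_continuous_chainFlow hω hl hβ hγ N (momentumFlip i₀ x) hη
  have hYc : ∀ j, Continuous fun s => ((pinnedChain ω₂ lam β γ).drift N (z' s)).2 j -
      ((pinnedChain ω₂ lam β γ).drift N (z s)).2 j := fun j =>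
    (pinnedChain_continuous_chainFlow_apply hω hl hβ hγ N (momentumFlip i₀ x) hη j).2.2.sub
      (pinnedChain_continuous_chainFlow_apply hω hl hβ hγ N x hη j).2.2
  have hvc : ∀ j, Continuous (v j) := fun j =>
    (((continuous_apply j).comp (continuous_fst.comp hz'c)).sub
        ((continuous_apply j).comp (continuous_fst.comp hzc))).abs.add
      (((continuous_apply j).comp (continuous_snd.comp hz'c)).sub
        ((continuous_apply j).comp (continuous_snd.comp hzc))).abs
  have huc : ∀ l, Continuous (u l) := fun l => by
    refine continuous_finsetSum _ fun j _ => ?_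
    split_ifs
    · exact hvc j
    · exact continuous_const
  -- the a priori bound on `[0, t]`
  obtain ⟨M, hM⟩ := (isCompact_Icc (a := (0 : ℝ)) (b := t)).exists_bound_of_continuousOn
    (hz'c.sub hzc).continuousOn
  set B : ℝ := 2 * max M 0 with hB
  have hB0 : 0 ≤ B := by positivity
  have hvB : ∀ j, ∀ s ∈ Icc 0 t, v j s ≤ B := by
    intro j s hs
    have hn : ‖z' s - z s‖ ≤ M := hM s hs
    have h1 : |(z' s).1 j - (z s).1 j| ≤ M :=
      calc |(z' s).1 j - (z s).1 j| = ‖(z' s - z s).1 j‖ := by rw [Real.norm_eq_abs]; rfl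
        _ ≤ ‖(z' s - z s).1‖ := norm_le_pi_norm _ j
        _ ≤ ‖z' s - z s‖ := norm_fst_le _
        _ ≤ M := hn
    have h2 : |(z' s).2 j - (z s).2 j| ≤ M :=
      calc |(z' s).2 j - (z s).2 j| = ‖(z' s - z s).2 j‖ := by rw [Real.norm_eq_abs]; rfl
        _ ≤ ‖(z' s - z s).2‖ := norm_le_pi_norm _ j
        _ ≤ ‖z' s - z s‖ := norm_snd_le _
        _ ≤ M := hn
    calc v j s = |(z' s).1 j - (z s).1 j| + |(z' s).2 j - (z s).2 j| := rfl
      _ ≤ M + M := add_le_add h1 h2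
      _ ≤ B := by rw [hB]; linarith [le_max_left M 0]
  have hu_bd : ∀ l, ∀ s ∈ Icc 0 t, u l s ≤ B * g (l - (i₀ : ℤ)).natAbs := fun l s hs =>
    (latticeSum_le hB0 (fun j => hvB j s hs) l).trans (le_mul_of_one_le_right hB0 (hg1 _))
  -- initial data: only the momentum of site `i₀` differs, by `2|p_{i₀}|`
  have hz0 : z 0 = x + ((0 : Fin N → ℝ), η 0) := pinnedChain_chainFlow_of_nonpos ω₂ lam β γ N x hη le_rfl
  have hz'0 : z' 0 = momentumFlip i₀ x + ((0 : Fin N → ℝ), η 0) :=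
    pinnedChain_chainFlow_of_nonpos ω₂ lam β γ N (momentumFlip i₀ x) hη le_rfl
  have hv_init : ∀ j, v j 0 = if j = i₀ then 2 * |x.2 i₀| else 0 := by
    intro j
    simp only [hv, hz0, hz'0, Prod.fst_add, Prod.snd_add, Pi.add_apply, momentumFlip_fst, sub_self,
      abs_zero, zero_add, add_sub_add_right_eq_sub]
    by_cases hj : j = i₀
    · subst hj
      rw [if_pos rfl, momentumFlip_snd_self, show -x.2 j - x.2 j = -(2 * x.2 j) by ring, abs_neg, abs_mul,
        abs_two]
    · rw [if_neg hj, momentumFlip_snd_of_ne hj, sub_self, abs_zero]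
  have hu_i : u i₀ 0 ≤ 2 * |x.2 i₀| := by rw [hu_coe, hv_init, if_pos rfl]
  have hu_0 : ∀ l, l ≠ (i₀ : ℤ) → u l 0 ≤ 0 := by
    intro l hl0
    refine le_of_eq (Finset.sum_eq_zero fun j _ => ?_)
    split_ifs with h
    · have hj : j ≠ i₀ := fun hji => hl0 (by rw [← h, hji])
      rw [hv_init, if_neg hj]
    · rfl
  -- the rate
  set A : ℝ := 3 + ω₂ + 3 * lam + 24 * β + 2 * γ with hA
  set a : ℝ := A * ρ ^ 2 with ha
  have hρ2 : 1 ≤ ρ ^ 2 := one_le_pow₀ hρ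
  have ha0 : 0 ≤ a := by positivity
  -- the integral inequalities
  have hu_int : ∀ l, ∀ τ ∈ Icc 0 t, u l τ ≤ u l 0 +
      a * g (l - (i₀ : ℤ)).natAbs * ∫ s in (0 : ℝ)..τ, (u (l - 1) s + u l s + u (l + 1) s) := by
    intro l τ hτ
    have hW0 : ∀ s, 0 ≤ u (l - 1) s + u l s + u (l + 1) s := fun s =>
      add_nonneg (add_nonneg (hu0 _ s) (hu0 _ s)) (hu0 _ s)
    have hWc : Continuous fun s => u (l - 1) s + u l s + u (l + 1) s := ((huc _).add (huc _)).add (huc _)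
    have hI0 : 0 ≤ ∫ s in (0 : ℝ)..τ, (u (l - 1) s + u l s + u (l + 1) s) :=
      intervalIntegral.integral_nonneg hτ.1 fun s _ => hW0 s
    by_cases hex : ∃ j : Fin N, (j : ℤ) = l
    · obtain ⟨j, rfl⟩ := hex
      -- the local box radius at site `j`
      set n : ℕ := ((j : ℤ) - (i₀ : ℤ)).natAbs with hn
      set R : ℝ := Real.sqrt (ρ ^ 2 * g n) with hR
      have hRg : R ^ 2 = ρ ^ 2 * g n := Real.sq_sqrt (by have := hg0 n; positivity)
      have hR1 : 1 ≤ R ^ 2 := by rw [hRg]; nlinarith [hg1 n]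
      have hboxR : ∀ s ∈ Icc 0 t, ∀ j' : Fin N, ((j' : ℤ) - j).natAbs ≤ 1 →
          |(z s).1 j'| ≤ R ∧ |(z' s).1 j'| ≤ R := by
        intro s hs j' hj'
        obtain ⟨h1, h2⟩ := hbox s hs j j' hj'
        refine ⟨?_, ?_⟩
        · rw [← Real.sqrt_sq_eq_abs, hR]; exact Real.sqrt_le_sqrt h1
        · rw [← Real.sqrt_sq_eq_abs, hR]; exact Real.sqrt_le_sqrt h2
      set L : ℝ := ω₂ + 3 * lam * R ^ 2 + 2 * (1 + 12 * β * R ^ 2) + 2 * γ with hL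
      have hKV0 : 0 ≤ 1 + 12 * β * R ^ 2 := by positivity
      have hKVL : 1 + 12 * β * R ^ 2 ≤ L := by rw [hL]; nlinarith
      have hL0 : 0 ≤ L := hKV0.trans hKVL
      have hLa : 1 + L ≤ a * g n := by
        have e : a * g n = A * R ^ 2 := by rw [ha, hRg]; ring
        rw [e, hL, hA]
        nlinarith [mul_nonneg (show (0 : ℝ) ≤ 3 + ω₂ + 2 * γ by positivity) (show (0 : ℝ) ≤ R ^ 2 - 1 by linarith)]
      obtain ⟨hq, hp⟩ := pinnedChain_chainFlow_sub_apply hω hl hβ hγ N x (momentumFlip i₀ x) hη j hτ.1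
      have hδ0 : (z' 0).1 j - (z 0).1 j = (momentumFlip i₀ x).1 j - x.1 j ∧
          (z' 0).2 j - (z 0).2 j = (momentumFlip i₀ x).2 j - x.2 j := by
        rw [hz0, hz'0]
        simp only [Prod.fst_add, Prod.snd_add, Pi.add_apply, Pi.zero_apply, add_zero, add_sub_add_right_eq_sub,
          and_self]
      -- positions
      have h1 : |(z' τ).1 j - (z τ).1 j| ≤ |(z' 0).1 j - (z 0).1 j| +
          ∫ s in (0 : ℝ)..τ, (u (j - 1) s + u j s + u (j + 1) s) := by
        have hbd : |∫ s in (0 : ℝ)..τ, ((z' s).2 j - (z s).2 j)| ≤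
            ∫ s in (0 : ℝ)..τ, (u (j - 1) s + u j s + u (j + 1) s) := by
          refine (intervalIntegral.abs_integral_le_integral_abs hτ.1).trans ?_
          refine intervalIntegral.integral_mono_on hτ.1 ?_ (hWc.intervalIntegrable _ _) fun s _ => ?_
          · exact ((((continuous_apply j).comp (continuous_snd.comp hz'c)).sub
              ((continuous_apply j).comp (continuous_snd.comp hzc))).abs).intervalIntegrable _ _
          · have := hd2 s j
            linarith [hu0 ((j : ℤ) - 1) s, hu0 ((j : ℤ) + 1) s]
        have e : (z' τ).1 j - (z τ).1 j = ((z' 0).1 j - (z 0).1 j) +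
            ∫ s in (0 : ℝ)..τ, ((z' s).2 j - (z s).2 j) := by rw [hδ0.1]; exact hq
        rw [e]
        exact (abs_add_le _ _).trans (by linarith)
      -- momenta
      have h2 : |(z' τ).2 j - (z τ).2 j| ≤ |(z' 0).2 j - (z 0).2 j| +
          L * ∫ s in (0 : ℝ)..τ, (u (j - 1) s + u j s + u (j + 1) s) := by
        have hbd : |∫ s in (0 : ℝ)..τ, (((pinnedChain ω₂ lam β γ).drift N (z' s)).2 j -
              ((pinnedChain ω₂ lam β γ).drift N (z s)).2 j)| ≤
            ∫ s in (0 : ℝ)..τ, L * (u (j - 1) s + u j s + u (j + 1) s) := by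
          refine (intervalIntegral.abs_integral_le_integral_abs hτ.1).trans ?_
          refine intervalIntegral.integral_mono_on hτ.1 ((hYc j).abs.intervalIntegrable _ _)
            ((hWc.const_mul L).intervalIntegrable _ _) fun s hs => ?_
          have hst : s ∈ Icc 0 t := ⟨hs.1, hs.2.trans hτ.2⟩
          have hF := abs_drift_snd_sub_le_local hω.le hl hβ hγ (z := z s) (z' := z' s) (R := R) j
            (fun j' hj' => (hboxR s hst j' hj').1) (fun j' hj' => (hboxR s hst j' hj').2) (d := fun l => u l s)
            (fun l => hu0 l s) (hd1 s) (hd2 s)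
          refine hF.trans ?_
          rw [← hL]
          have hm := hu0 ((j : ℤ) - 1) s
          have hp' := hu0 ((j : ℤ) + 1) s
          nlinarith
        rw [intervalIntegral.integral_const_mul] at hbd
        have e : (z' τ).2 j - (z τ).2 j = ((z' 0).2 j - (z 0).2 j) +
            ∫ s in (0 : ℝ)..τ, (((pinnedChain ω₂ lam β γ).drift N (z' s)).2 j -
              ((pinnedChain ω₂ lam β γ).drift N (z s)).2 j) := by rw [hδ0.2]; exact hp
        rw [e]
        exact (abs_add_le _ _).trans (by linarith)
      -- combine
      rw [hu_coe, hu_coe]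
      calc v j τ = |(z' τ).1 j - (z τ).1 j| + |(z' τ).2 j - (z τ).2 j| := rfl
        _ ≤ (|(z' 0).1 j - (z 0).1 j| + |(z' 0).2 j - (z 0).2 j|) +
            (1 + L) * ∫ s in (0 : ℝ)..τ, (u (j - 1) s + u j s + u (j + 1) s) := by linarith
        _ ≤ v j 0 + a * g n * ∫ s in (0 : ℝ)..τ, (u (j - 1) s + u j s + u (j + 1) s) :=
            add_le_add le_rfl (mul_le_mul_of_nonneg_right hLa hI0)
    · push Not at hex
      have hul : ∀ s, u l s = 0 := fun s => latticeSum_of_forall_ne (fun j => v j s) hex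
      rw [hul τ, hul 0, zero_add]
      exact mul_nonneg (mul_nonneg ha0 (hg0 _)) hI0
  -- the Dobrushin–Fritz iteration with the weight `g`
  have hit := BMLightCone.lattice_iteration_far (g := g) (u := u) (i := (i₀ : ℤ)) (j := (k : ℤ)) hg1 hgm hg3 hg4
    ht (by positivity) ha0 hB0 (fun l => (huc l).continuousOn) hu_bd hu_i hu_0 hu_int hk' hθ
  rwa [hu_coe] at hit

end WeightedPropagation

open WeightedPropagation in
/-- **Registered helper `chainFlow_momentumFlip_propagation_weighted`** (pathwise core of stub (C′)
`stub_uniformAnchoredCorrelationTails`, line `series-law-at-every-laplace-frequency`): the weighted common-noise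
propagation bound for the flow of the pinned anharmonic chain between its two Langevin baths — two solutions
driven by the SAME continuous noise path, from `x` and from `x` with the momentum of site `i₀` flipped, whose
positions near each site `j` obey the WEIGHTED box `q² ≤ ρ² g(|j - i₀|)` on `[0, t]` (`g` an admissible weight of
the abstract Dobrushin–Fritz iteration, `ρ ≥ 1`), differ at every site `k ≠ i₀` by at most `2(2|p_{i₀}|)2^{-|k-i₀|}`
in the regime `2e · 3(Aρ²) g(2|k - i₀|) t ≤ |k - i₀|`, `A = 3 + ω₂ + 3 lam + 24 β + 2γ`. [folklore] -/
theorem chainFlow_momentumFlip_propagation_weighted :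
    ∀ ω₂ lam β γ : ℝ, 0 < ω₂ → 0 ≤ lam → 0 ≤ β → 0 ≤ γ →
      ∀ g : ℕ → ℝ, (∀ n, 1 ≤ g n) → Monotone g → (∀ n : ℕ, g n ≤ 3 + n) →
        (∀ m m' : ℕ, 1 ≤ m → m ≤ m' → (m : ℝ) * g (2 * m') ≤ m' * g (2 * m)) →
      ∀ (N : ℕ) (i₀ : Fin N) (x : Literature.MathematicalPhysics.KineticTheory.HeatConduction.PhaseSpace N)
        (η : ℝ → Fin N → ℝ), Continuous η → ∀ (ρ t : ℝ), 1 ≤ ρ → 0 ≤ t →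
        (∀ s ∈ Set.Icc (0 : ℝ) t, ∀ j j' : Fin N, ((j' : ℤ) - j).natAbs ≤ 1 →
          ((Literature.MathematicalPhysics.KineticTheory.HeatConduction.pinnedChain ω₂ lam β γ).chainFlow N x η
              s).1 j' ^ 2 ≤ ρ ^ 2 * g ((j : ℤ) - i₀).natAbs ∧
          ((Literature.MathematicalPhysics.KineticTheory.HeatConduction.pinnedChain ω₂ lam β γ).chainFlow N
              (Literature.MathematicalPhysics.KineticTheory.HeatConduction.momentumFlip i₀ x) η s).1 j' ^ 2 ≤
            ρ ^ 2 * g ((j : ℤ) - i₀).natAbs) →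
        ∀ k : Fin N, k ≠ i₀ →
          2 * Real.exp 1 * (3 * ((3 + ω₂ + 3 * lam + 24 * β + 2 * γ) * ρ ^ 2) *
              g (2 * ((k : ℤ) - i₀).natAbs) * t) ≤ ((k : ℤ) - i₀).natAbs →
          |((Literature.MathematicalPhysics.KineticTheory.HeatConduction.pinnedChain ω₂ lam β γ).chainFlow N
                  (Literature.MathematicalPhysics.KineticTheory.HeatConduction.momentumFlip i₀ x) η t).1 k -
              ((Literature.MathematicalPhysics.KineticTheory.HeatConduction.pinnedChain ω₂ lam β γ).chainFlow N
                  x η t).1 k| +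
            |((Literature.MathematicalPhysics.KineticTheory.HeatConduction.pinnedChain ω₂ lam β γ).chainFlow N
                  (Literature.MathematicalPhysics.KineticTheory.HeatConduction.momentumFlip i₀ x) η t).2 k -
              ((Literature.MathematicalPhysics.KineticTheory.HeatConduction.pinnedChain ω₂ lam β γ).chainFlow N
                  x η t).2 k| ≤
            2 * (2 * |x.2 i₀|) * (1 / 2) ^ ((k : ℤ) - i₀).natAbs :=
  fun _ _ _ _ hω hl hβ hγ _ hg1 hgm hg3 hg4 N i₀ x _ hη _ _ hρ ht hbox _ hk hθ =>
    propagation_weighted hω hl hβ hγ hg1 hgm hg3 hg4 N i₀ x hη hρ ht hbox hk hθ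

end Summit.AtomisticToContinuum.FouriersLaw.Theorems.AbelThermodynamicLimit.SeriesLawAtEveryLaplaceFrequency

end
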